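import Summits.Ventures.WeilGRH.TwistedMomentCertSound
import Summits.Ventures.WeilGRH.TwistedMomentCells
import Literature.NumberTheory.LFunctions.WeilFinitePrimeQuadraticChar
import HarnessLib

/-!
# Moment-method certificates for TWISTED Weil weights, V: from a checked certificate to the rung of `L(s, χ)`

Cell `rh-explicit`, WEIL TRACK — GRH ARM (namespace `Summit.Ventures.WeilGRH`).  The Dirichlet-character entry
point of the polar-free moment-method certificates (files I–IV): for a character `χ` mod `q ≠ 1` with a REAL
value `χ(2) = s ∈ {−1, 0, 1}` (any parity, imprimitive allowed), a twisted chain of cells accepted by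
`checkCellsZS s …` (file II) and an algebraic certificate accepted by `TwistCert.checkAlg` (file III) with
`ellLo ≤ log q − log π` give

* `weilFinitePrimeQuadraticChar_nonneg_of_twistCert` — `0 ≤ E_{χ,2}(g)` for every test function `g` with
  `tsupport g ⊆ [−b, b]` (`E_{χ,2} = (1/2π)∫|ĝ|² M_{χ,2}`, `Literature/…/WeilFinitePrimeQuadraticChar.lean`);
* **`weilPositivityOnChar_of_twistCert`** — the rung `WeilPositivityOnChar χ t` for every `t ≤ b` with
  `e^{2t} ≤ 3` (`weilQuadraticChar_re_eq_weilFinitePrimeQuadraticChar`), in particular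
  `weilPositivityOnChar_log_three_half_of_twistCert` : `WeilPositivityOnChar χ (log 3 / 2)` when
  `logThreeHiQ / 2 ≤ b`.

The dictionary `M_{χ,2} − (log q − log π) ≥ twistWeight s` is `weilPrimeRippleChar_two_of_chi_two` (the prime-2
ripple of `M_{χ,2}` is `s·√2 log 2·cos(τ log 2)` when `χ(2) = s`) with `twistWeight_le_parity` (the parity bonus
`π sech(πτ) ≥ 0` of an odd `χ` is dropped).  So a kernel evaluation `decide` of the two Boolean checkers on
certificate DATA is a proof of the rung — the route by which the `χ`-specific cells of conductor `≤ 9` that no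
reduction to `ζ` reaches (the Legendre symbol mod 5 at `(log 3)/2`, …) become theorems.  Everything here is
PROVED; no named facts; nothing is claimed about zeros of `L(s, χ)`.

## References

* A. Weil, *Sur les "formules explicites" de la théorie des nombres premiers* (1952), (11) pp. 261–262 and the
  «lemme» p. 262.
* H. Yoshida, *On Hermitian forms attached to zeta functions*, Adv. Stud. Pure Math. 21 (1992), §6, Thm 1.
-/

noncomputable section

open Complex Finset MeasureTheory Set Filter
open scoped Real Topology ComplexConjugate BigOperators ArithmeticFunction.vonMangoldt

namespace Summit.Ventures.WeilGRH

open Literature.NumberTheory.LFunctions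
open Literature.Analysis.ValidatedNumerics.Numerics
open Literature.Analysis.SpecialFunctions

variable {q : ℕ}

/-! ## The prime-2 ripple of `M_{χ,2}` for a real value `χ(2) = s` -/

/-- For `χ(2) = s` real, the twisted ripple on the window `N = 2` is `s · √2 log 2 · cos(τ log 2)`
(`Λ(0) = Λ(1) = 0`, `Λ(2)/√2 · 2 = √2 log 2`). [folklore] -/
theorem weilPrimeRippleChar_two_of_chi_two (χ : DirichletCharacter ℂ q) {s : ℤ}
    (hχ2 : χ ((2 : ℕ) : ZMod q) = (s : ℂ)) (τ : ℝ) :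
    weilPrimeRippleChar χ 2 τ = (s : ℝ) * (Real.sqrt 2 * Real.log 2 * Real.cos (τ * Real.log 2)) := by
  unfold weilPrimeRippleChar
  rw [Finset.sum_range_succ, Finset.sum_range_succ, Finset.sum_range_succ, Finset.sum_range_zero]
  have h0 : (Λ 0 : ℝ) = 0 := by simp
  have h1 : (Λ 1 : ℝ) = 0 := by simp
  have h2 : (Λ 2 : ℝ) = Real.log 2 := by
    rw [ArithmeticFunction.vonMangoldt_apply_prime Nat.prime_two]; push_cast; ring
  rw [h0, h1, h2, hχ2]
  have hre : ((s : ℂ)).re = (s : ℝ) := by simp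
  have him : ((s : ℂ)).im = 0 := by simp
  rw [hre, him]
  have hs2 : Real.sqrt 2 ≠ 0 := by positivity
  have hs22 : Real.sqrt 2 ^ 2 = 2 := Real.sq_sqrt (by norm_num)
  push_cast
  field_simp
  rw [hs22]
  ring

/-- **Dictionary.** For `χ` mod `q` with `χ(2) = s` real, the finite-prime weight on the window `N = 2` minus
its constant level dominates the twisted model weight of file II:
`twistWeight s τ ≤ M_{χ,2}(τ) − (log q − log π)` (equality for even `χ`). [folklore] -/
theorem twistWeight_le_weilFinitePrimeWeightChar_sub (χ : DirichletCharacter ℂ q) {s : ℤ}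
    (hχ2 : χ ((2 : ℕ) : ZMod q) = (s : ℂ)) (τ : ℝ) :
    twistWeight s τ ≤ weilFinitePrimeWeightChar χ 2 τ - (Real.log q - Real.log π) := by
  unfold weilFinitePrimeWeightChar
  rw [weilPrimeRippleChar_two_of_chi_two χ hχ2 τ]
  have h := twistWeight_le_parity s (charParity_le_one χ) τ
  linarith

/-! ## From the two checkers to the rung -/

/-- **`E_{χ,2} ≥ 0` on `C(b)` from a checked twisted certificate.** For `χ` mod `q` (any parity) with
`χ(2) = s ∈ {−1, 0, 1}`, cells accepted by `checkCellsZS s p j wL T M`, an algebraic certificate accepted by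
`checkAlg`, and `ellLo ≤ log q − log π`: `0 ≤ E_{χ,2}(g)` for every test function `g` with
`tsupport g ⊆ [−b, b]`. [folklore] -/
theorem weilFinitePrimeQuadraticChar_nonneg_of_twistCert (c : TwistCert) {s : ℤ} {p j M : ℕ}
    (hcells : checkCellsZS s p j c.base.wL c.base.T M c.cells = true) (halg : c.checkAlg = true)
    (χ : DirichletCharacter ℂ q) (hχ2 : χ ((2 : ℕ) : ZMod q) = (s : ℂ))
    (hℓ : ((c.ellLo : ℚ) : ℝ) ≤ Real.log q - Real.log π)
    {g : ℝ → ℂ} (hg : IsWeilTest g) (hsupp : tsupport g ⊆ Icc (-(c.b : ℝ)) c.b) :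
    0 ≤ weilFinitePrimeQuadraticChar χ 2 g := by
  have hOK := cellsOKW_of_checkCellsZS hcells
  set W : ℝ → ℝ := fun τ ↦ weilFinitePrimeWeightChar χ 2 τ - (Real.log q - Real.log π) with hW
  have hwW : ∀ τ, twistWeight s τ ≤ W τ := fun τ ↦ twistWeight_le_weilFinitePrimeWeightChar_sub χ hχ2 τ
  have hWi : Integrable fun t : ℝ ↦ ‖weilMellin g (1 / 2 + t * I)‖ ^ 2 * W t := by
    have h1 := integrable_norm_sq_weilMellin_mul_weilFinitePrimeWeightChar hg χ 2
    have h2 := (integrable_norm_sq_weilMellin_half_line hg).mul_const (Real.log q - Real.log π)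
    refine (h1.sub h2).congr (Eventually.of_forall fun τ ↦ ?_)
    simp only [Pi.sub_apply, hW]
    ring
  have hmain := TwistCert.form_nonneg_of_check_mono halg hOK (twistWeight_neg s) hwW hℓ hg hWi hsupp
  -- `E_{χ,2}(g) = ℓ‖g‖₂² + (1/2π)∫|ĝ|² W`
  have hsplit : weilFinitePrimeQuadraticChar χ 2 g =
      (Real.log q - Real.log π) * weilNorm2Sq g +
        1 / (2 * π) * ∫ t : ℝ, ‖weilMellin g (1 / 2 + t * I)‖ ^ 2 * W t := by
    unfold weilFinitePrimeQuadraticChar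
    have h1 := integrable_norm_sq_weilMellin_half_line hg
    have e : (fun τ : ℝ ↦ ‖weilMellin g (1 / 2 + τ * I)‖ ^ 2 * weilFinitePrimeWeightChar χ 2 τ) =
        fun τ : ℝ ↦ ‖weilMellin g (1 / 2 + τ * I)‖ ^ 2 * W τ +
          (Real.log q - Real.log π) * ‖weilMellin g (1 / 2 + τ * I)‖ ^ 2 := by
      funext τ; rw [hW]; ring
    rw [e, integral_add hWi (h1.const_mul _), integral_const_mul, integral_norm_sq_weilMellin_half_line hg]
    set X := ∫ t : ℝ, ‖weilMellin g (1 / 2 + t * I)‖ ^ 2 * W t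
    have hπ : (π : ℝ) ≠ 0 := Real.pi_ne_zero
    field_simp
    ring
  rw [hsplit]
  exact hmain

/-- **The rung from a checked twisted certificate.** Under the hypotheses of
`weilFinitePrimeQuadraticChar_nonneg_of_twistCert` and `q ≠ 1`: `WeilPositivityOnChar χ t` for every
`t ≤ b` with `e^{2t} ≤ 3` (on such windows `Re Q_χ(g) = E_{χ,2}(g)`). [folklore] -/
theorem weilPositivityOnChar_of_twistCert (c : TwistCert) {s : ℤ} {p j M : ℕ}
    (hcells : checkCellsZS s p j c.base.wL c.base.T M c.cells = true) (halg : c.checkAlg = true)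
    (hq : q ≠ 1) (χ : DirichletCharacter ℂ q) (hχ2 : χ ((2 : ℕ) : ZMod q) = (s : ℂ))
    (hℓ : ((c.ellLo : ℚ) : ℝ) ≤ Real.log q - Real.log π)
    {t : ℝ} (htb : t ≤ (c.b : ℝ)) (ht3 : Real.exp (2 * t) ≤ 3) :
    WeilPositivityOnChar χ t := by
  intro g hg hsupp
  have h3 : Real.exp (2 * t) ≤ ((2 : ℕ) : ℝ) + 1 := by norm_num; exact ht3
  rw [weilQuadraticChar_re_eq_weilFinitePrimeQuadraticChar hq χ hg h3 hsupp]
  exact weilFinitePrimeQuadraticChar_nonneg_of_twistCert c hcells halg χ hχ2 hℓ hg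
    (hsupp.trans (Icc_subset_Icc (by linarith) htb))

/-- **The `(log 3)/2` rung from a checked twisted certificate** with `logThreeHiQ/2 ≤ b`
(`logThreeHiQ ≥ log 3`, `WeilSharpConstants.lean`). [folklore] -/
theorem weilPositivityOnChar_log_three_half_of_twistCert (c : TwistCert) {s : ℤ} {p j M : ℕ}
    (hcells : checkCellsZS s p j c.base.wL c.base.T M c.cells = true) (halg : c.checkAlg = true)
    (hb : logThreeHiQ / 2 ≤ c.b)
    (hq : q ≠ 1) (χ : DirichletCharacter ℂ q) (hχ2 : χ ((2 : ℕ) : ZMod q) = (s : ℂ))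
    (hℓ : ((c.ellLo : ℚ) : ℝ) ≤ Real.log q - Real.log π) :
    WeilPositivityOnChar χ (Real.log 3 / 2) := by
  refine weilPositivityOnChar_of_twistCert c hcells halg hq χ hχ2 hℓ ?_ ?_
  · have h1 : Real.log 3 ≤ ((logThreeHiQ : ℚ) : ℝ) := logThree_le
    have h2 : (((logThreeHiQ / 2 : ℚ)) : ℝ) ≤ c.b := by exact_mod_cast hb
    push_cast at h2
    linarith
  · rw [show 2 * (Real.log 3 / 2) = Real.log 3 by ring, Real.exp_log (by norm_num)]

end Summit.Ventures.WeilGRH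

end
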